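import Mathlib.GroupTheory.GroupAction.Quotient
import Mathlib.SetTheory.Cardinal.Finite
import Mathlib.SetTheory.Cardinal.NatCard

/-!
# Free actions of a finite group on finite sets of the same size are isomorphic

Folklore (permutation representations): a free action of a finite group `G` on a finite set `X` is
isomorphic to `G × (X/G)` with `G` acting by left translation on the first factor
(`exists_equiv_prod_quotient_of_free`); consequently two free finite `G`-sets of the same cardinality
are `G`-equivariantly isomorphic (`exists_equivariant_equiv_of_free`).  Recorded for the abc-iut cell
(layer L3): the "free" finite étale coverings used to verify [IUTchI] Rmk. 2.5.3 (i) (T4)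
(Galois-countability of strictly coherent semi-graphs of anabelioids) glue along edges by this lemma.
[cite: Mochizuki2012, IUTchI Rem. 2.5.3(i)(T4) p.53]  Proof-only (no definitions).
-/

namespace Literature.GroupTheory.PermutationGroups

universe u v w

variable {G : Type u} [Group G]

/-- A free `G`-set is `G × (X/G)`: there is a bijection `X ≃ G × X/G` which is `G`-equivariant for
the left translation action on the first factor (send `x = g · x_ω`, `x_ω` the chosen representative of
the orbit `ω` of `x`, to `(g, ω)`); the orbit decomposition behind the "free" coverings of
[IUTchI] Rmk. 2.5.3 (i). [cite: Mochizuki2012, IUTchI Rem. 2.5.3(i)(T4) p.53] -/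
theorem exists_equiv_prod_quotient_of_free {X : Type v} [MulAction G X]
    (hX : ∀ (g : G) (x : X), g • x = x → g = 1) :
    ∃ e : X ≃ G × Quotient (MulAction.orbitRel G X),
      ∀ (g : G) (x : X), e (g • x) = (g * (e x).1, (e x).2) := by
  classical
  let q : X → Quotient (MulAction.orbitRel G X) := Quotient.mk _
  -- every point is a translate of the representative of its orbit, by a unique group element
  have hrep : ∀ x : X, ∃ g : G, g • (q x).out = x := by
    intro x
    have : (q x).out ∈ MulAction.orbit G x := Quotient.mk_out (s := MulAction.orbitRel G X) x
    obtain ⟨g, hg⟩ := this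
    refine ⟨g⁻¹, ?_⟩
    rw [← hg, inv_smul_smul]
  choose γ hγ using hrep
  have huniq : ∀ (x : X) (g : G), g • (q x).out = x → g = γ x := by
    intro x g hg
    have h1 : (g⁻¹ * γ x) • (q x).out = (q x).out := by
      rw [mul_smul, hγ]
      exact inv_smul_eq_iff.mpr hg.symm
    have := hX _ _ h1
    rw [inv_mul_eq_one] at this
    exact this
  have hq : ∀ (g : G) (ω : Quotient (MulAction.orbitRel G X)), q (g • ω.out) = ω := by
    intro g ω
    calc q (g • ω.out) = q ω.out := Quotient.sound ⟨g, rfl⟩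
      _ = ω := Quotient.out_eq ω
  refine ⟨{ toFun := fun x => (γ x, q x), invFun := fun p => p.1 • p.2.out,
             left_inv := fun x => hγ x, right_inv := fun p => ?_ }, fun g x => ?_⟩
  · obtain ⟨g, ω⟩ := p
    have h2 : q (g • ω.out) = ω := hq g ω
    refine Prod.ext ?_ h2
    change γ (g • ω.out) = g
    symm
    apply huniq
    rw [h2]
  · refine Prod.ext ?_ ?_
    · change γ (g • x) = g * γ x
      symm
      apply huniq
      have h2 : q (g • x) = q x := Quotient.sound ⟨g, rfl⟩
      rw [h2, mul_smul, hγ]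
    · change q (g • x) = q x
      exact Quotient.sound ⟨g, rfl⟩

/-- **Free finite `G`-sets of equal size are isomorphic**: if a finite group `G` acts freely on finite
sets `X`, `Y` with `|X| = |Y|`, there is a `G`-equivariant bijection `X ≃ Y` (the gluing step of the free
finite étale coverings in [IUTchI] Rmk. 2.5.3 (i) (T4)). [cite: Mochizuki2012, IUTchI Rem. 2.5.3(i)(T4) p.53] -/
theorem exists_equivariant_equiv_of_free [Finite G] {X : Type v} {Y : Type w} [Finite X] [Finite Y]
    [MulAction G X] [MulAction G Y] (hX : ∀ (g : G) (x : X), g • x = x → g = 1)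
    (hY : ∀ (g : G) (y : Y), g • y = y → g = 1) (h : Nat.card X = Nat.card Y) :
    ∃ e : X ≃ Y, ∀ (g : G) (x : X), e (g • x) = g • e x := by
  classical
  obtain ⟨eX, heX⟩ := exists_equiv_prod_quotient_of_free hX
  obtain ⟨eY, heY⟩ := exists_equiv_prod_quotient_of_free hY
  haveI : Finite (Quotient (MulAction.orbitRel G X)) := Quotient.finite _
  haveI : Finite (Quotient (MulAction.orbitRel G Y)) := Quotient.finite _
  have hcard : Nat.card (Quotient (MulAction.orbitRel G X)) =
      Nat.card (Quotient (MulAction.orbitRel G Y)) := by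
    have h1 := Nat.card_congr eX
    have h2 := Nat.card_congr eY
    rw [Nat.card_prod] at h1 h2
    have hG : Nat.card G ≠ 0 := Nat.card_pos.ne'
    apply Nat.eq_of_mul_eq_mul_left (Nat.pos_of_ne_zero hG)
    rw [← h1, ← h2, h]
  obtain ⟨β⟩ := Finite.card_eq.mp hcard
  refine ⟨eX.trans (((Equiv.refl G).prodCongr β).trans eY.symm), fun g x => ?_⟩
  simp only [Equiv.trans_apply, Equiv.prodCongr_apply, Equiv.coe_refl, Prod.map_apply, id_eq, heX]
  -- `eY.symm (g * a, b) = g • eY.symm (a, b)`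
  apply eY.injective
  rw [Equiv.apply_symm_apply, heY, Equiv.apply_symm_apply]
  rfl

end Literature.GroupTheory.PermutationGroups
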